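import Summits.ValiantsHypothesis.ValiantsHypothesis.Theorems.LacunarySymmetroidMatrixDescartesCensusDoorA34SheetWindowGramOrientationLaw

/-!
# `MatrixDescartes` census — DOOR A at `(3,4)`: the DOOR's one-dominant-eigenvalue regime with a SAME-SIGN minor pair — a non-negative combination of the diagonal
# entries of a five-root `2 × 2` window pencil has no root beyond the five

HONEST FRAMING.  Object-search cell `pub-symmetroid`, engine seat `val-sym-eng-2` (g11); helper row beside the registered strata line
`Cruxes/DoorA34/Lines/strata.lean` on stmt-ValiantsHypothesis-19980 (`DoorA34 = PosRootLawAt 3 4 18`: OPEN, typed, never asserted here).  The g10 report §6(g) read the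
orientation law on the FULL door (rank-three top letter `S₃ = diag(μ₁, μ₂, μ₃)` in its eigenframe, three-scale `|μ₁| ≫ |μ₂| ≫ |μ₃|`): the window levels of
`det(F + x^N S₃) = det F + x^N·Σᵢ μᵢ·adj F_ii + x^{2N}·Σ_{i<j} μᵢμⱼ·F_kk + x^{3N}·μ₁μ₂μ₃` are `det F | μ₁·det(F|v₁^⊥) | μ₁μ₂·F₃₃ | const`, and five level-1 roots make
`F|v₁^⊥` definite beyond them (`Census.det_pencil_pos_beyond_roots`), killing the level-2 diagonal entry (`Census.diag_ne_zero_beyond_roots`): flag ceiling `18`.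
This file records the one-line extension to a top letter with ONE dominant eigenvalue and a minor pair `μ₂, μ₃` OF THE SAME SIGN at ANY ratio: then level 2 is
`μ₁·(μ₃·F₂₂ + μ₂·F₃₃)` up to the lower-order `μ₂μ₃·F₁₁`, a SAME-SIGN combination of the two diagonal entries of `F|v₁^⊥`, and

* `posCombination_diag_ne_zero_beyond_roots` — for a real symmetric three-letter `2 × 2` pencil on a window support (`0 < d₁`, `2d₁ < d₂`) whose determinant has at
  least five positive roots, and `a, b ≥ 0` not both zero, the combination `a·M₀₀ + b·M₁₁` of the diagonal entries of the evaluated pencil `M = Σₗ x^{dₗ}Sₗ` vanishes at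
  NO `x` beyond all real roots of the determinant (the pencil is definite there, so its diagonal entries are non-zero of one sign).

So in the door's flag regime «one dominant eigenvalue, minor pair of the same sign» the flag `(γ₁, γ₂) = (5, ≥ 1)` is dead exactly as in the three-scale regime
(prose; the level bookkeeping is asymptotic in `N` and not typed); the residual door flag regime is a minor pair of OPPOSITE signs (level 2 a difference of diagonal
entries) — the door's copy of the sheet's indefinite cell (…SheetWindowGramPrinciple `orientation_bilinear`: free orientation).  Nothing here bounds anything;
`DoorA34` and the three stubs stay OPEN; registers unchanged (`ζ_sym(3,4) ∈ {18,19}`); nothing on `MatrixDescartes` (stmt-ValiantsHypothesis-18050) or on `VP ≠ VNP` —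
VP≠VNP not moved.  [folklore] `2 × 2` definiteness.
-/

-- `Summit.ValiantsHypothesis.ValiantsHypothesis.…` repeats a component by the D-0017 layout
-- (single-conjunct summit), which the `dupNamespace` linter flags; the name is mandated.
set_option linter.dupNamespace false

namespace Summit.ValiantsHypothesis.ValiantsHypothesis.Theorems.LacunarySymmetroidMatrixDescartes.Census

open scoped BigOperators Matrix
open Polynomial Finset

/-- **Same-sign diagonal combinations have no root beyond five determinant roots** (window supports).  If the determinant of the real symmetric three-letter
`2 × 2` pencil `Σₗ X^{dₗ}Sₗ`, `d = (0, d₁, d₂)`, `0 < d₁`, `2d₁ < d₂`, has at least five distinct positive roots, then for every `x` beyond all its real roots and all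
`a, b ≥ 0` with `0 < a + b`: `a·M₀₀ + b·M₁₁ ≠ 0`, `M = Σₗ x^{dₗ}Sₗ` — indeed `det M > 0` there (`Census.det_pencil_pos_beyond_roots`), so `M₀₀M₁₁ > M₀₁² ≥ 0`
and the two diagonal entries are non-zero of the same sign. [folklore] -/
theorem posCombination_diag_ne_zero_beyond_roots (d₁ d₂ : ℕ) (hd₁ : 0 < d₁) (hw : 2 * d₁ < d₂) (S : Fin 3 → Matrix (Fin 2) (Fin 2) ℝ)
    (hS : ∀ l, (S l).IsSymm)
    (h5 : 5 ≤ (((∑ l, (X : ℝ[X]) ^ (![0, d₁, d₂] : Fin 3 → ℕ) l • (S l).map C).det).roots.toFinset.filter (fun t => 0 < t)).card)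
    (x : ℝ) (hbeyond : ∀ t, ((∑ l, (X : ℝ[X]) ^ (![0, d₁, d₂] : Fin 3 → ℕ) l • (S l).map C).det).IsRoot t → t < x)
    (a b : ℝ) (ha : 0 ≤ a) (hb : 0 ≤ b) (hab : 0 < a + b) :
    a * (∑ l, x ^ (![0, d₁, d₂] : Fin 3 → ℕ) l • S l) 0 0 + b * (∑ l, x ^ (![0, d₁, d₂] : Fin 3 → ℕ) l • S l) 1 1 ≠ 0 := by
  have hdet := det_pencil_pos_beyond_roots d₁ d₂ hd₁ hw S hS h5 x hbeyond
  set M : Matrix (Fin 2) (Fin 2) ℝ := ∑ l, x ^ (![0, d₁, d₂] : Fin 3 → ℕ) l • S l with hM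
  have hMsymm : M 1 0 = M 0 1 := by
    have h : ∀ l, S l 1 0 = S l 0 1 := fun l => by simpa [Matrix.transpose_apply] using congrFun (congrFun (hS l) 0) 1
    simp only [hM, Matrix.sum_apply, Matrix.smul_apply, smul_eq_mul, h]
  rw [Matrix.det_fin_two, hMsymm] at hdet
  -- `M₀₀ · M₁₁ > M₀₁² ≥ 0`: the diagonal entries are non-zero of one sign
  have hprod : 0 < M 0 0 * M 1 1 := by nlinarith [sq_nonneg (M 0 1)]
  intro h0
  rcases lt_or_gt_of_ne (show M 0 0 ≠ 0 from fun h => by rw [h, zero_mul] at hprod; exact lt_irrefl _ hprod) with hneg | hpos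
  · have h11 : M 1 1 < 0 := by
      by_contra hge; push Not at hge
      have : M 0 0 * M 1 1 ≤ 0 := mul_nonpos_of_nonpos_of_nonneg hneg.le hge
      linarith
    -- a·M₀₀ + b·M₁₁ ≤ 0 with equality only if a = b = 0
    have h1 : a * M 0 0 ≤ 0 := mul_nonpos_of_nonneg_of_nonpos ha hneg.le
    have h2 : b * M 1 1 ≤ 0 := mul_nonpos_of_nonneg_of_nonpos hb h11.le
    have ha0 : a * M 0 0 = 0 := by linarith
    have hb0 : b * M 1 1 = 0 := by linarith
    have : a = 0 := by
      rcases mul_eq_zero.1 ha0 with h | h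
      · exact h
      · exact absurd h hneg.ne
    have : b = 0 := by
      rcases mul_eq_zero.1 hb0 with h | h
      · exact h
      · exact absurd h h11.ne
    linarith
  · have h11 : 0 < M 1 1 := by
      by_contra hle; push Not at hle
      have : M 0 0 * M 1 1 ≤ 0 := mul_nonpos_of_nonneg_of_nonpos hpos.le hle
      linarith
    have h1 : 0 ≤ a * M 0 0 := mul_nonneg ha hpos.le
    have h2 : 0 ≤ b * M 1 1 := mul_nonneg hb h11.le
    have ha0 : a * M 0 0 = 0 := by linarith
    have hb0 : b * M 1 1 = 0 := by linarith
    have : a = 0 := by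
      rcases mul_eq_zero.1 ha0 with h | h
      · exact h
      · exact absurd h hpos.ne'
    have : b = 0 := by
      rcases mul_eq_zero.1 hb0 with h | h
      · exact h
      · exact absurd h h11.ne'
    linarith

end Summit.ValiantsHypothesis.ValiantsHypothesis.Theorems.LacunarySymmetroidMatrixDescartes.Census
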